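import Summits.CriticalPhenomena.Ising3DConformalLimit.Theses.UnitLightCone
import Summits.CriticalPhenomena.Ising3DConformalLimit.Theorems.HyperoctahedralRPTwoPointLimitIsotropicHolds
import HarnessLib
import HarnessLib.Audit.Check

/-!
# Line `yukawa-subordination` — crux `UnitSpeedTwoPoint` (route UnitLightCone, item stmt-CriticalPhenomena-17167)

Crux-strategist line (planner-cstrat-stmt-CriticalPhenomena-17167-b1-0, 2026-08-17), registered ALONGSIDE the
birth line `Lines/birth.lean` (stubs `stub_radialProfile`, `stub_unitConeKLPowerLaw`).  Same transfer as `birth`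
(the landed two-point isotropy `HyperoctahedralRPTwoPoint.kernel_rotation_invariant` + the window/positivity/
homogeneity glue `twoPointKernelOfLimit_proof` make the Ising limit kernel `K = C₀‖x‖^{-2Δ}`, `C₀ > 0`,
`1/2 ≤ Δ ≤ 1`, so the crux IS the unit-cone Källén–Lehmann representation of the conformal power kernel), but the
monolithic XL stub `stub_unitConeKLPowerLaw` (`∃ μ …` for `C (a²+b²+t²)^{-Δ}`) is FACTORED through the MASS
SUBORDINATION `r^{-2Δ} = ∫ (e^{-mr}/r) dν_Δ(m)` into three independently landable classical lemmas, each with a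
Bessel-free blueprint over lemmas that are already in the tree / Mathlib, and the radial-profile stub of `birth` is
discharged inside the glue (Cartan–Dieudonné via `Submodule.reflection_sub`, as in the landed
`SpineGlue.const_on_sphere_of_isometry_invariant`).  TECHNIQUE: Källén–Lehmann by mass subordination —
(A) Bernstein measure of `r^{1-2Δ}`; (B) the Sommerfeld–Weyl MIXED representation of the Yukawa potential
`e^{-mr}/r = (2π)⁻¹ ∫_{ℝ²} cos(k·w) e^{-Ω|t|} Ω⁻¹ d²k`, `Ω = √(|k|² + m²) ≥ |k|`, proved by GAUSSIAN SUBORDINATION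
(`e^{-Ω|t|}/Ω = π^{-1/2} ∫₀^∞ u^{-1/2} e^{-t²/(4u)} e^{-uΩ²} du`, Mathlib's Gaussian Fourier transform on
`EuclideanSpace ℝ (Fin 2)`, one Fubini, and the tree's `K_{±1/2}` integrals
`Literature.Analysis.SpecialFunctions.BesselKHalf.integral_inv_sqrt_mul_exp_eq` /
`integral_inv_sqrt_mul_inv_mul_exp_neg_div_add_mul`); (C) the CONE PUSHFORWARD: the image of
`(2πΩ)⁻¹ d²k ⊗ ν` under `(k, m) ↦ (k, Ω(k, m))` is a measure on `ℝ² × ℝ` carried by `{ω ≥ |k|}` realising the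
superposition (Fubini + `integral_map`).  The unit light cone is then AUTOMATIC: `Ω(k,m) ≥ ‖k‖` pointwise, so the
support clause is the measure of an EMPTY preimage — no spectral-edge estimate, no lattice, no limit.

* `stub_laplaceMeasurePowerLaw` (A, S–M): for `Δ ≥ 1/2` an s-finite measure `ν` on `ℝ` carried by `[0, ∞)` with
  `∫ e^{-mr} dν(m) = r^{1-2Δ}` for all `r > 0` (with integrability).  `Δ = 1/2`: `ν = δ₀`; `Δ > 1/2`:
  `dν = Γ(2Δ-1)⁻¹ m^{2Δ-2} 1_{m>0} dm` (`Real.integral_rpow_mul_exp_neg_mul_Ioi`).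
* `stub_sommerfeldWeyl` (B, L, load-bearing): for `m ≥ 0`, `t ≠ 0`, `a b : ℝ`: `k ↦ e^{-Ω|t|}/Ω` is integrable on
  `ℝ²` and `∫ cos(k₀a + k₁b) e^{-Ω|t|}/Ω d²k = 2π e^{-m r}/r`, `r = √(a² + b² + t²)` (numerically confirmed to 3·10⁻⁵,
  planner folder `check_sw.py`, four cases incl. `m = 0`).
* `stub_conePushforward` (C, M): for any s-finite `ν` carried by `[0,∞)` with `e^{-mr} ∈ L¹(ν)` (`r > 0`) and any
  family satisfying (B)'s conclusion, there is `μ` on `ℝ² × ℝ` with `μ{ω < |k|} = 0` and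
  `∫ cos(k₀a + k₁b) e^{-ω|t|} dμ = ∫ e^{-mr}/r dν(m)` (`t ≠ 0`).

Composition `UnitSpeedTwoPoint_of : A → B → C → UnitSpeedTwoPoint` (sorry-free, kernel-checked): tree input ⇒
`K x = C₀ ‖x‖^{-2Δ}` off `0` (`radial_of_isometry_invariant`, proved here), `C₀ = K e₂ > 0`; A at `Δ` gives `ν`;
C fed with B gives `μ₀`; `μ := C₀ • μ₀`; both frame points have norm `√(transverse² + t²)`, and
`C₀ · r^{1-2Δ}/r = C₀ r^{-2Δ}`.  Device `__Registered` as in the sibling skeletons (hypotheses of `_of` admissible BY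
NAME for `#h21_check_skeleton`); a closing `example` feeds the three `stub_…` theorems verbatim.

Disproof used: none exists for this crux (`ledger crux ls stmt-CriticalPhenomena-17167`, 2026-08-17: only
`Lines/birth.{lean,md}`; no `Disproof.lean`, no `Theorems/UnitSpeedTwoPoint/Negative/*`); the summit's negatives index
(Cardy / percolation / SAW statements) contains no Källén–Lehmann statement.  The refuter's crux-attack note
(2026-08-17T06:09Z) records the same reduction and blueprint ingredients; this file types them as registered stubs.
-/

noncomputable section

namespace Summit.CriticalPhenomena.Ising3DConformalLimit.Cruxes.UnitSpeedTwoPoint.YukawaSubordination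

open MeasureTheory
open Literature.Probability.LatticeModels

/-! ### The registered stubs (the only `sorry`s of the file) -/

/-- STUB A (S–M, 1-D Laplace transforms; the `Δ`-carrier) — **Bernstein measure of `r^{1-2Δ}`**: for `Δ ≥ 1/2`
there is an s-finite positive measure `ν` on `ℝ` carried by `[0, ∞)` such that `m ↦ e^{-mr}` is `ν`-integrable and
`∫ e^{-mr} dν(m) = r^{1-2Δ}` for every `r > 0`.  Witness: `Δ = 1/2`: `ν = Measure.dirac 0`; `Δ > 1/2`:
`ν = (volume.restrict (Ioi 0)).withDensity (m ↦ m^{2Δ-2}/Γ(2Δ-1))`, and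
`∫₀^∞ m^{(2Δ-1)-1} e^{-rm} dm = r^{-(2Δ-1)} Γ(2Δ-1)` is `Real.integral_rpow_mul_exp_neg_mul_Ioi`.  Why it might
fail: it does not (complete monotonicity of `r^{-s}`, `s ≥ 0`); the cost is the `withDensity`/`dirac` bookkeeping.
Sources: Widder, *The Laplace Transform* (1941) Ch. IV; Berg–Christensen–Ressel 1984 §4.  -/
theorem stub_laplaceMeasurePowerLaw :
    ∀ Δ : ℝ, 1 / 2 ≤ Δ →
      ∃ ν : MeasureTheory.Measure ℝ, MeasureTheory.SFinite ν ∧ ν (Set.Iio 0) = 0 ∧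
        ∀ r : ℝ, 0 < r →
          MeasureTheory.Integrable (fun m : ℝ => Real.exp (-(m * r))) ν ∧
            ∫ m, Real.exp (-(m * r)) ∂ν = r ^ (1 - 2 * Δ) := by
  sorry

/-- STUB B (L, the load-bearing stub) — **Sommerfeld–Weyl mixed representation of the Yukawa potential in `d = 3`**:
for `m ≥ 0`, `t ≠ 0` and `a b : ℝ`, with `Ω(k) = √(‖k‖² + m²)` on `ℝ² = EuclideanSpace ℝ (Fin 2)`,
`k ↦ e^{-Ω|t|}/Ω` is integrable and `∫ cos(k₀ a + k₁ b) e^{-Ω|t|}/Ω d²k = 2π e^{-m r}/r`, `r = √(a² + b² + t²)`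
(the `p₃`-integral of the `3`-D Fourier representation of `e^{-mr}/(4πr) = (p² + m²)⁻¹`; `m = 0` is Weyl's integral
`1/r = (2π)⁻¹ ∫ cos(k·w) e^{-|k||t|} |k|⁻¹ d²k`).  Bessel-free blueprint (Gaussian subordination): (1) for `Ω > 0`,
`e^{-Ω|t|}/Ω = π^{-1/2} ∫₀^∞ u^{-1/2} e^{-t²/(4u)} e^{-uΩ²} du` — the `K_{1/2}` integral
`∫₀^∞ u^{-1/2} e^{-(β/u + αu)} du = √(π/α) e^{-2√(αβ)}` (scale `Literature…BesselKHalf.integral_inv_sqrt_mul_exp_eq`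
by `u = √(β/α) s`, exactly as `integral_inv_sqrt_mul_inv_mul_exp_neg_div_add_mul` is obtained there); (2) Fubini on
`ℝ² × (0,∞)` (absolutely convergent for `t ≠ 0`: with the prefactor `π^{-1/2}` the majorant integrates to `2π e^{-m|t|}/|t|`); (3) the
Gaussian Fourier transform `∫_{ℝ²} cos(k₀a + k₁b) e^{-u‖k‖²} d²k = (π/u) e^{-(a²+b²)/(4u)}` = real part of Mathlib's
`GaussianFourier.integral_cexp_neg_mul_sq_norm_add_of_euclideanSpace` (`b = u`, `c = I`, `w = (a, b)`); (4) the
`K_{-1/2}` integral `√π ∫₀^∞ u^{-3/2} e^{-r²/(4u)} e^{-um²} du = 2π e^{-mr}/r`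
(`Literature…BesselKHalf.integral_inv_sqrt_mul_inv_mul_exp_neg_div_add_mul`, `β = r²/4`, `α = m²`; for `m = 0` the
plain Γ(1/2)-integral after `u ↦ 1/u`).  Integrability of `e^{-Ω|t|}/Ω` comes out of the same computation done with
`lintegral`s (Tonelli needs no integrability).  At `k = 0, m = 0` the integrand is Lean's `x/0 = 0` (a null set).
Why it might fail: it does not (classical identity; constant `2π` confirmed numerically in four cases incl. `m = 0`);
the cost is one honest Fubini over `EuclideanSpace ℝ (Fin 2) × Ioi 0`.  Sources: Watson, *Bessel Functions* §13.47;
Glimm–Jaffe 1987 §6.2 / §7.2 (lattice & continuum free covariance); Stein–Weiss 1971 Ch. I §1 (subordination of the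
Poisson kernel to the Gauss kernel). -/
theorem stub_sommerfeldWeyl :
    ∀ m t a b : ℝ, 0 ≤ m → t ≠ 0 →
      MeasureTheory.Integrable (fun k : EuclideanSpace ℝ (Fin 2) =>
          Real.exp (-(Real.sqrt (‖k‖ ^ 2 + m ^ 2) * |t|)) / Real.sqrt (‖k‖ ^ 2 + m ^ 2)) ∧
        ∫ k : EuclideanSpace ℝ (Fin 2), Real.cos (k 0 * a + k 1 * b) *
            (Real.exp (-(Real.sqrt (‖k‖ ^ 2 + m ^ 2) * |t|)) / Real.sqrt (‖k‖ ^ 2 + m ^ 2)) =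
          2 * Real.pi * Real.exp (-(m * Real.sqrt (a ^ 2 + b ^ 2 + t ^ 2))) /
            Real.sqrt (a ^ 2 + b ^ 2 + t ^ 2) := by
  sorry

/-- STUB C (M, measure theory) — **cone pushforward**: for every s-finite measure `ν` on `ℝ` carried by `[0,∞)`
with `m ↦ e^{-mr}` integrable for all `r > 0`, and every mass family obeying the Sommerfeld–Weyl conclusion of
STUB B (taken as a HYPOTHESIS, so this stub is independent of B's proof), there is a measure `μ` on `ℝ² × ℝ` giving
zero mass to the spacelike region `{ω < |k|}` with `∫ cos(k₀a + k₁b) e^{-ω|t|} dμ(k, ω) = ∫ e^{-mr}/r dν(m)` for all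
`a b` and `t ≠ 0`, `r = √(a² + b² + t²)`.  Witness: `μ = Measure.map (fun q => (q.1, √(‖q.1‖² + q.2²)))
((volume.prod ν).withDensity (fun q => ENNReal.ofReal ((2π)⁻¹ / √(‖q.1‖² + q.2²))))`; the support clause is the
measure of the EMPTY preimage `{√(‖k‖² + m²) < ‖k‖}`; the formula is `integral_map` +
`integral_withDensity_eq_integral_smul` + Fubini (`integrable_prod_iff`: sections integrable by the hypothesis,
`m ↦ ∫ |integrand| d²k ≤ e^{-m|t|}/|t|` by the hypothesis at `a = b = 0`, integrable `dν`) + the hypothesis `ν`-a.e.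
(`ν (Iio 0) = 0`).  Why it might fail: it does not; the cost is product-measurability / Fubini bookkeeping on
`EuclideanSpace ℝ (Fin 2) × ℝ`.  Sources: Glimm–Jaffe 1987 §6.2 (Källén–Lehmann as a superposition of free
covariances); Reed–Simon II §IX.8. -/
theorem stub_conePushforward :
    ∀ ν : MeasureTheory.Measure ℝ, MeasureTheory.SFinite ν → ν (Set.Iio 0) = 0 →
      (∀ r : ℝ, 0 < r → MeasureTheory.Integrable (fun m : ℝ => Real.exp (-(m * r))) ν) →
      (∀ m t a b : ℝ, 0 ≤ m → t ≠ 0 →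
        MeasureTheory.Integrable (fun k : EuclideanSpace ℝ (Fin 2) =>
            Real.exp (-(Real.sqrt (‖k‖ ^ 2 + m ^ 2) * |t|)) / Real.sqrt (‖k‖ ^ 2 + m ^ 2)) ∧
          ∫ k : EuclideanSpace ℝ (Fin 2), Real.cos (k 0 * a + k 1 * b) *
              (Real.exp (-(Real.sqrt (‖k‖ ^ 2 + m ^ 2) * |t|)) / Real.sqrt (‖k‖ ^ 2 + m ^ 2)) =
            2 * Real.pi * Real.exp (-(m * Real.sqrt (a ^ 2 + b ^ 2 + t ^ 2))) /
              Real.sqrt (a ^ 2 + b ^ 2 + t ^ 2)) →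
      ∃ μ : MeasureTheory.Measure (EuclideanSpace ℝ (Fin 2) × ℝ),
        μ {p : EuclideanSpace ℝ (Fin 2) × ℝ | p.2 < ‖p.1‖} = 0 ∧
          ∀ t a b : ℝ, t ≠ 0 →
            ∫ p, Real.cos (p.1 0 * a + p.1 1 * b) * Real.exp (-(p.2 * |t|)) ∂μ =
              ∫ m, Real.exp (-(m * Real.sqrt (a ^ 2 + b ^ 2 + t ^ 2))) /
                Real.sqrt (a ^ 2 + b ^ 2 + t ^ 2) ∂ν := by
  sorry

/-! ### The three stub statements BY NAME — the hypotheses of `UnitSpeedTwoPoint_of`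

`#h21_check_skeleton` admits a hypothesis of the composing theorem only if its head constant is a registered
obligation or is NAMED like a declared stub; so each `stub_X : <signature> := by sorry` above is mirrored by
`abbrev __Registered.stub_X : Prop := <the same signature, verbatim>` (device of the sibling skeletons). -/
namespace __Registered

/-- Alias of the statement of the registered stub `stub_laplaceMeasurePowerLaw` (A), keyed by its name. -/
abbrev stub_laplaceMeasurePowerLaw : Prop :=
    ∀ Δ : ℝ, 1 / 2 ≤ Δ →
      ∃ ν : MeasureTheory.Measure ℝ, MeasureTheory.SFinite ν ∧ ν (Set.Iio 0) = 0 ∧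
        ∀ r : ℝ, 0 < r →
          MeasureTheory.Integrable (fun m : ℝ => Real.exp (-(m * r))) ν ∧
            ∫ m, Real.exp (-(m * r)) ∂ν = r ^ (1 - 2 * Δ)

/-- Alias of the statement of the registered stub `stub_sommerfeldWeyl` (B), keyed by its name. -/
abbrev stub_sommerfeldWeyl : Prop :=
    ∀ m t a b : ℝ, 0 ≤ m → t ≠ 0 →
      MeasureTheory.Integrable (fun k : EuclideanSpace ℝ (Fin 2) =>
          Real.exp (-(Real.sqrt (‖k‖ ^ 2 + m ^ 2) * |t|)) / Real.sqrt (‖k‖ ^ 2 + m ^ 2)) ∧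
        ∫ k : EuclideanSpace ℝ (Fin 2), Real.cos (k 0 * a + k 1 * b) *
            (Real.exp (-(Real.sqrt (‖k‖ ^ 2 + m ^ 2) * |t|)) / Real.sqrt (‖k‖ ^ 2 + m ^ 2)) =
          2 * Real.pi * Real.exp (-(m * Real.sqrt (a ^ 2 + b ^ 2 + t ^ 2))) /
            Real.sqrt (a ^ 2 + b ^ 2 + t ^ 2)

/-- Alias of the statement of the registered stub `stub_conePushforward` (C), keyed by its name. -/
abbrev stub_conePushforward : Prop :=
    ∀ ν : MeasureTheory.Measure ℝ, MeasureTheory.SFinite ν → ν (Set.Iio 0) = 0 →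
      (∀ r : ℝ, 0 < r → MeasureTheory.Integrable (fun m : ℝ => Real.exp (-(m * r))) ν) →
      (∀ m t a b : ℝ, 0 ≤ m → t ≠ 0 →
        MeasureTheory.Integrable (fun k : EuclideanSpace ℝ (Fin 2) =>
            Real.exp (-(Real.sqrt (‖k‖ ^ 2 + m ^ 2) * |t|)) / Real.sqrt (‖k‖ ^ 2 + m ^ 2)) ∧
          ∫ k : EuclideanSpace ℝ (Fin 2), Real.cos (k 0 * a + k 1 * b) *
              (Real.exp (-(Real.sqrt (‖k‖ ^ 2 + m ^ 2) * |t|)) / Real.sqrt (‖k‖ ^ 2 + m ^ 2)) =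
            2 * Real.pi * Real.exp (-(m * Real.sqrt (a ^ 2 + b ^ 2 + t ^ 2))) /
              Real.sqrt (a ^ 2 + b ^ 2 + t ^ 2)) →
      ∃ μ : MeasureTheory.Measure (EuclideanSpace ℝ (Fin 2) × ℝ),
        μ {p : EuclideanSpace ℝ (Fin 2) × ℝ | p.2 < ‖p.1‖} = 0 ∧
          ∀ t a b : ℝ, t ≠ 0 →
            ∫ p, Real.cos (p.1 0 * a + p.1 1 * b) * Real.exp (-(p.2 * |t|)) ∂μ =
              ∫ m, Real.exp (-(m * Real.sqrt (a ^ 2 + b ^ 2 + t ^ 2))) /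
                Real.sqrt (a ^ 2 + b ^ 2 + t ^ 2) ∂ν

end __Registered

/-! ### Sorry-free glue: radial profile, frame geometry, power algebra -/

/-- **Radial profile (model-blind, proved; replaces `birth`'s stub S1).** A `(-2Δ)`-homogeneous kernel on `ℝ³`
invariant under every linear isometry equals `K e₂ · ‖x‖^{-2Δ}` off the origin: `x = ‖x‖ • u` with `‖u‖ = 1`, and
`K u = K e₂` because the reflection in `(e₂ - u)ᗮ` maps `e₂` to `u` (`Submodule.reflection_sub`, Cartan–Dieudonné;
cf. the landed `SpineGlue.const_on_sphere_of_isometry_invariant`). -/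
theorem radial_of_isometry_invariant (Δ : ℝ) (K : EuclideanSpace ℝ (Fin 3) → ℝ)
    (hhom : ∀ c : ℝ, 0 < c → ∀ x, K (c • x) = c ^ (-(2 * Δ)) * K x)
    (hrot : ∀ (R : EuclideanSpace ℝ (Fin 3) ≃ₗᵢ[ℝ] EuclideanSpace ℝ (Fin 3)) (x : EuclideanSpace ℝ (Fin 3)),
      K (R x) = K x)
    (x : EuclideanSpace ℝ (Fin 3)) (hx : x ≠ 0) :
    K x = K (EuclideanSpace.single 2 1) * ‖x‖ ^ (-(2 * Δ)) := by
  have hn : 0 < ‖x‖ := norm_pos_iff.mpr hx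
  set u : EuclideanSpace ℝ (Fin 3) := ‖x‖⁻¹ • x with hu
  have hu1 : ‖u‖ = 1 := by
    rw [hu, norm_smul, norm_inv, norm_norm, inv_mul_cancel₀ hn.ne']
  have he1 : ‖(EuclideanSpace.single 2 (1 : ℝ) : EuclideanSpace ℝ (Fin 3))‖ = 1 := by simp
  have hxu : x = ‖x‖ • u := by
    rw [hu, smul_smul, mul_inv_cancel₀ hn.ne', one_smul]
  have hKu : K u = K (EuclideanSpace.single 2 1) := by
    have h := Submodule.reflection_sub
      (show ‖(EuclideanSpace.single 2 (1 : ℝ) : EuclideanSpace ℝ (Fin 3))‖ = ‖u‖ by rw [hu1, he1])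
    have h2 := hrot ((ℝ ∙ ((EuclideanSpace.single 2 (1 : ℝ) : EuclideanSpace ℝ (Fin 3)) - u))ᗮ.reflection)
      (EuclideanSpace.single 2 1)
    rw [h] at h2
    exact h2
  calc K x = K (‖x‖ • u) := by rw [← hxu]
    _ = ‖x‖ ^ (-(2 * Δ)) * K u := hhom _ hn u
    _ = K (EuclideanSpace.single 2 1) * ‖x‖ ^ (-(2 * Δ)) := by rw [hKu, mul_comm]

/-- `‖x‖² = x₀² + x₁² + x₂²` on `ℝ³`. -/
theorem norm_sq_three (x : EuclideanSpace ℝ (Fin 3)) : ‖x‖ ^ 2 = x 0 ^ 2 + x 1 ^ 2 + x 2 ^ 2 := by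
  rw [EuclideanSpace.norm_eq, Real.sq_sqrt (by positivity), Fin.sum_univ_three]
  simp only [Real.norm_eq_abs, sq_abs]

/-- `‖x‖ = √(x₀² + x₁² + x₂²)` on `ℝ³`. -/
theorem norm_eq_sqrt_three (x : EuclideanSpace ℝ (Fin 3)) :
    ‖x‖ = Real.sqrt (x 0 ^ 2 + x 1 ^ 2 + x 2 ^ 2) := by
  rw [← norm_sq_three, Real.sqrt_sq (norm_nonneg _)]

/-- The axis-frame point `a e₀ + b e₁ + t e₂` has norm `√(a² + b² + t²)` and is nonzero when `t ≠ 0`. -/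
theorem axisPoint_norm (a b t : ℝ) :
    ‖(EuclideanSpace.single 0 a + EuclideanSpace.single 1 b + EuclideanSpace.single 2 t :
        EuclideanSpace ℝ (Fin 3))‖ = Real.sqrt (a ^ 2 + b ^ 2 + t ^ 2) := by
  set p : EuclideanSpace ℝ (Fin 3) :=
    EuclideanSpace.single 0 a + EuclideanSpace.single 1 b + EuclideanSpace.single 2 t with hp
  have h0 : p 0 = a := by simp [hp]
  have h1 : p 1 = b := by simp [hp]
  have h2 : p 2 = t := by simp [hp]
  rw [norm_eq_sqrt_three, h0, h1, h2]

theorem axisPoint_ne_zero (a b t : ℝ) (ht : t ≠ 0) :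
    (EuclideanSpace.single 0 a + EuclideanSpace.single 1 b + EuclideanSpace.single 2 t :
        EuclideanSpace ℝ (Fin 3)) ≠ 0 := by
  intro h
  have h2 : (EuclideanSpace.single 0 a + EuclideanSpace.single 1 b + EuclideanSpace.single 2 t :
      EuclideanSpace ℝ (Fin 3)) 2 = t := by simp
  rw [h] at h2
  exact ht (by simpa using h2.symm)

/-- The face-diagonal-frame point `((t+u)/√2) e₀ + ((t-u)/√2) e₁ + v e₂` has norm `√(u² + v² + t²)`. -/
theorem diagPoint_norm (t u v : ℝ) :
    ‖(EuclideanSpace.single 0 ((t + u) / Real.sqrt 2) + EuclideanSpace.single 1 ((t - u) / Real.sqrt 2) +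
        EuclideanSpace.single 2 v : EuclideanSpace ℝ (Fin 3))‖ = Real.sqrt (u ^ 2 + v ^ 2 + t ^ 2) := by
  set q : EuclideanSpace ℝ (Fin 3) :=
    EuclideanSpace.single 0 ((t + u) / Real.sqrt 2) + EuclideanSpace.single 1 ((t - u) / Real.sqrt 2) +
      EuclideanSpace.single 2 v with hq
  have h0 : q 0 = (t + u) / Real.sqrt 2 := by simp [hq]
  have h1 : q 1 = (t - u) / Real.sqrt 2 := by simp [hq]
  have h2 : q 2 = v := by simp [hq]
  have hsum : q 0 ^ 2 + q 1 ^ 2 + q 2 ^ 2 = u ^ 2 + v ^ 2 + t ^ 2 := by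
    rw [h0, h1, h2, div_pow, div_pow, Real.sq_sqrt (by norm_num : (0:ℝ) ≤ 2)]
    ring
  rw [norm_eq_sqrt_three, hsum]

theorem diagPoint_ne_zero (t u v : ℝ) (ht : t ≠ 0) :
    (EuclideanSpace.single 0 ((t + u) / Real.sqrt 2) + EuclideanSpace.single 1 ((t - u) / Real.sqrt 2) +
        EuclideanSpace.single 2 v : EuclideanSpace ℝ (Fin 3)) ≠ 0 := by
  intro h
  have hs : Real.sqrt 2 ≠ 0 := by positivity
  have e0 : (EuclideanSpace.single 0 ((t + u) / Real.sqrt 2) + EuclideanSpace.single 1 ((t - u) / Real.sqrt 2) +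
      EuclideanSpace.single 2 v : EuclideanSpace ℝ (Fin 3)) 0 = (t + u) / Real.sqrt 2 := by simp
  have e1 : (EuclideanSpace.single 0 ((t + u) / Real.sqrt 2) + EuclideanSpace.single 1 ((t - u) / Real.sqrt 2) +
      EuclideanSpace.single 2 v : EuclideanSpace ℝ (Fin 3)) 1 = (t - u) / Real.sqrt 2 := by simp
  rw [h] at e0 e1
  have e0' : (t + u) / Real.sqrt 2 = 0 := by simpa using e0.symm
  have e1' : (t - u) / Real.sqrt 2 = 0 := by simpa using e1.symm
  rw [div_eq_zero_iff, or_iff_left hs] at e0' e1'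
  exact ht (by linarith)

/-- `r^{1-2Δ}/r = r^{-2Δ}` for `r > 0`. -/
theorem rpow_one_sub_div_self {r : ℝ} (hr : 0 < r) (Δ : ℝ) :
    r ^ (1 - 2 * Δ) / r = r ^ (-(2 * Δ)) := by
  rw [← Real.rpow_sub_one hr.ne']
  congr 1
  ring

/-- The superposition `∫ e^{-mr}/r dν = r^{-2Δ}` once `∫ e^{-mr} dν = r^{1-2Δ}` (`r > 0`). -/
theorem integral_yukawa_mixture_eq {ν : MeasureTheory.Measure ℝ} {r Δ : ℝ} (hr : 0 < r)
    (h : ∫ m, Real.exp (-(m * r)) ∂ν = r ^ (1 - 2 * Δ)) :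
    ∫ m, Real.exp (-(m * r)) / r ∂ν = r ^ (-(2 * Δ)) := by
  rw [MeasureTheory.integral_div, h, rpow_one_sub_div_self hr]

/-! ### The composition (kernel-checked, no `sorry`) -/

/-- **`UnitSpeedTwoPoint` from the three stubs and the tree.**  For an admissible limit `(ρ, Δ, S)`: the kernel
`K x = S 2 (0, x)` has `1/2 ≤ Δ ≤ 1`, `K > 0` off `0`, homogeneity `-2Δ` (`twoPointKernelOfLimit_proof`, item 1983)
and `O(3)`-invariance (`kernel_rotation_invariant`, milestone 1984), all LANDED; `radial_of_isometry_invariant` makes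
it `C₀ ‖x‖^{-2Δ}` off `0` with `C₀ = K e₂ > 0`.  Stub A at `Δ` gives the mass measure `ν`; stub C fed with stub B
gives the cone measure `μ₀` of `∫ e^{-mr}/r dν = r^{-2Δ}`; `μ := C₀ • μ₀` serves both frames since the axis point
`a e₀ + b e₁ + t e₂` has norm `√(a² + b² + t²)` and the diagonal point `((t+u)/√2) e₀ + ((t-u)/√2) e₁ + v e₂` has
norm `√(u² + v² + t²)`. -/
theorem UnitSpeedTwoPoint_of (hA : __Registered.stub_laplaceMeasurePowerLaw)
    (hB : __Registered.stub_sommerfeldWeyl) (hC : __Registered.stub_conePushforward) :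
    Summit.CriticalPhenomena.Ising3DConformalLimit.Theses.UnitLightCone.UnitSpeedTwoPoint := by
  intro ρ Δ S hρ hlim _hnorm hnd htr hsc
  -- tree input: window, positivity, homogeneity (item 1983) and O(3)-invariance (milestone 1984)
  obtain ⟨⟨hΔ1, _hΔ2⟩, _hcont, hpos, hhom, _hmirror⟩ :=
    Summit.CriticalPhenomena.Ising3DConformalLimit.HyperoctahedralRPTwoPoint.twoPointKernelOfLimit_proof
      ρ Δ S hρ hlim hnd htr hsc
  have hrot : ∀ (R : EuclideanSpace ℝ (Fin 3) ≃ₗᵢ[ℝ] EuclideanSpace ℝ (Fin 3)) (x : EuclideanSpace ℝ (Fin 3)),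
      (fun q : EuclideanSpace ℝ (Fin 3) => S 2 ![0, q]) (R x) = (fun q => S 2 ![0, q]) x :=
    fun R x =>
      Summit.CriticalPhenomena.Ising3DConformalLimit.HyperoctahedralRPTwoPoint.kernel_rotation_invariant
        hρ hlim hnd htr hsc R x
  -- radial profile: K x = C₀ ‖x‖^{-2Δ} off 0, C₀ = K e₂ > 0
  set C₀ : ℝ := S 2 ![0, (EuclideanSpace.single 2 (1 : ℝ) : EuclideanSpace ℝ (Fin 3))] with hC₀
  have hK : ∀ x : EuclideanSpace ℝ (Fin 3), x ≠ 0 → S 2 ![0, x] = C₀ * ‖x‖ ^ (-(2 * Δ)) :=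
    fun x hx => radial_of_isometry_invariant Δ (fun q => S 2 ![0, q]) hhom hrot x hx
  have hC₀pos : 0 < C₀ := by
    have he : (EuclideanSpace.single 2 (1 : ℝ) : EuclideanSpace ℝ (Fin 3)) ≠ 0 := by
      intro h
      have h2 : (EuclideanSpace.single 2 (1 : ℝ) : EuclideanSpace ℝ (Fin 3)) 2 = 0 := by rw [h]; rfl
      simp at h2
    exact hpos _ he
  -- stub A: the mass measure ν of r^{1-2Δ}
  obtain ⟨ν, hsf, hν0, hν⟩ := hA Δ hΔ1
  -- stub C fed with stub B: the cone measure of ∫ e^{-mr}/r dν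
  obtain ⟨μ₀, hμ₀supp, hμ₀⟩ := hC ν hsf hν0 (fun r hr => (hν r hr).1) hB
  -- scale by C₀
  have hsupp : ((ENNReal.ofReal C₀) • μ₀) {p : EuclideanSpace ℝ (Fin 2) × ℝ | p.2 < ‖p.1‖} = 0 := by
    rw [Measure.smul_apply, hμ₀supp, smul_zero]
  have hval : ∀ t a b : ℝ, t ≠ 0 →
      ∫ p, Real.cos (p.1 0 * a + p.1 1 * b) * Real.exp (-(p.2 * |t|)) ∂((ENNReal.ofReal C₀) • μ₀) =
        C₀ * Real.sqrt (a ^ 2 + b ^ 2 + t ^ 2) ^ (-(2 * Δ)) := by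
    intro t a b ht
    have hr : 0 < Real.sqrt (a ^ 2 + b ^ 2 + t ^ 2) := by
      apply Real.sqrt_pos.2
      have : 0 < t ^ 2 := by positivity
      positivity
    rw [integral_smul_measure, hμ₀ t a b ht, ENNReal.toReal_ofReal hC₀pos.le, smul_eq_mul,
      integral_yukawa_mixture_eq hr (hν _ hr).2]
  refine ⟨⟨(ENNReal.ofReal C₀) • μ₀, hsupp, fun t a b ht => ?_⟩,
    ⟨(ENNReal.ofReal C₀) • μ₀, hsupp, fun t u v ht => ?_⟩⟩
  · -- axis frame `e₂`
    show S 2 ![0, _] = _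
    rw [hK _ (axisPoint_ne_zero a b t ht), axisPoint_norm, hval t a b ht]
  · -- face-diagonal frame `(e₀ + e₁)/√2`
    show S 2 ![0, _] = _
    rw [hK _ (diagPoint_ne_zero t u v ht), diagPoint_norm, hval t u v ht]

/-- The registered stubs discharge the hypotheses of `UnitSpeedTwoPoint_of` verbatim (an `example`, so no
pre-composed sorry-tainted witness of the crux enters the environment; its only `sorry`s are the stubs'). -/
example : Summit.CriticalPhenomena.Ising3DConformalLimit.Theses.UnitLightCone.UnitSpeedTwoPoint :=
  UnitSpeedTwoPoint_of stub_laplaceMeasurePowerLaw stub_sommerfeldWeyl stub_conePushforward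

end Summit.CriticalPhenomena.Ising3DConformalLimit.Cruxes.UnitSpeedTwoPoint.YukawaSubordination

end

#h21_check_skeleton "stmt-CriticalPhenomena-17167" Summit.CriticalPhenomena.Ising3DConformalLimit.Theses.UnitLightCone.UnitSpeedTwoPoint stub_laplaceMeasurePowerLaw stub_sommerfeldWeyl stub_conePushforward
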